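import Summits.CriticalPhenomena.PercolationContinuityZ3.Theorems.PercNearOneGluingNoHeavyLowerTailSahiCombTriWHalfChainHall
import Summits.CriticalPhenomena.PercolationContinuityZ3.Theorems.PercNearOneGluingNoHeavyLowerTailSahiCombTriWHalfChainStratum

/-!
# `HalfChainHall` HOLDS (typed link)

Support file of the one-cut programme (crux `NoHeavyLowerTail`, stmt-CriticalPhenomena-4575; cell `prim-masterthm`, seat P5 gen 29).
`…TriWHalfChainHall` (P5 gen 28) states the half-chain Hall target `FiveUpSet.HalfChainHall` (`halfChainDemand ≤ halfChainSupply` on the stratum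
`Gp ⊆ Gq`) as a `@[conjecture] def`; `…TriWHalfChainStratum` (this seat) proves the equivalent pair inequality `halfChain_pair_nonneg` from the kernel lemma
of design HC-0.  This file records the typed discharge.

* **`FiveUpSet.halfChainHall_holds : HalfChainHall`** — `halfChain_pair_nonneg` + the exact identity `inner_pair_eq_halfChain`.
HONEST LABEL: elementary (std axioms). [this work]
-/

namespace Summit.CriticalPhenomena.PercolationContinuityZ3.Theorems

namespace FiveUpSet

open Finset

/-- **`HalfChainHall` holds**: for up-sets `P`, `F₀ ⊆ Fp, Fq ⊆ F₁`, `G₀ ⊆ Gp ⊆ Gq ⊆ G₁` of a finite cube, `halfChainDemand ≤ halfChainSupply`. [this work] -/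
theorem halfChainHall_holds : HalfChainHall := by
  intro γ _ _ P F₀ Fp Fq F₁ G₀ Gp Gq G₁ hP hF₀ hFp hFq hF₁ hG₀ hGp hGq hG₁ hF0p hF0q hFp1 hFq1 hG0p hGpq hGq1
  have h := halfChain_pair_nonneg P F₀ Fp Fq F₁ G₀ Gp Gq G₁ hP hF₀ hFp hFq hF₁ hG₀ hGp hGq hG₁ hF0p hF0q hFp1 hFq1 hG0p hGpq hGq1
  rw [inner_pair_eq_halfChain P F₀ Fp Fq F₁ G₀ Gp Gq G₁ hF0p hF0q hFp1 hFq1 hG0p (hG0p.trans hGpq) (hGpq.trans hGq1) hGq1 hGpq] at h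
  omega

end FiveUpSet

end Summit.CriticalPhenomena.PercolationContinuityZ3.Theorems
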